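import Summits.ResolutionOfSingularities.ResolutionOfSingularities.Theorems.EquisingularLiftEquisingularLiftNatTCPlusInvBaseKCL
import Summits.ResolutionOfSingularities.ResolutionOfSingularities.Theorems.EquisingularLiftEquisingularLiftNatReducedExceptionalPlaneLocal
import Summits.ResolutionOfSingularities.ResolutionOfSingularities.Theorems.EquisingularLiftEquisingularLiftNatHorizChainE1Sections
import Summits.ResolutionOfSingularities.ResolutionOfSingularities.Theorems.EquisingularLiftEquisingularLiftCentreBlowupFlatExceptional
import Summits.ResolutionOfSingularities.ResolutionOfSingularities.Theorems.EquisingularLiftEquisingularLiftNatSubchainSupplierInvSDefs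
import HarnessLib

/-!
# [OURS · L1 W4.5(b) · EL♮(3) · T23-A″-S] `invS_base` — THE INVARIANT WITH LOCALIZED SHADOW, CARTIER CLAUSE, PLANE TRACE AND PLANE FLATNESS AT THE
# FIRST POINT STEP: `TCPlus.InvS O k θ P q Y Ch W F₂ (𝟙 F₂) T₂ Z₂ (St_x W) (υ⁻¹{x}) false` — twins of res-type-100's S7 bricks
# (…NatTCPlusMemberKCLUncentred p574417, …NatTCPlusInvBaseKCL p576847) (crux `EquisingularLiftNatThree` = stmt-ResolutionOfSingularities-20148)

res-type-027 g18, brick (S-6) of the object «A″-S UPSTAIRS TWINS» (res-L1-w45b-plan-1 desk RULING R20 (iv) / DESK WORD 2026-08-28T08:15:46Z; res-L1-w45b-stub-4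
T23-A″ ENGINE WORD 16d03a46d50c8ccd §S and SHAPE WORD 08:22:44Z). OURS; NOT a statement of any manuscript ([Hironaka2017] is a candidate under adjudication,
nothing of it is asserted); AI-written, weaker than expert review; `--supports stmt-ResolutionOfSingularities-20148 --as helper`; closes nothing by itself.
Definition-free.

WHAT. The three S7 bricks of res-type-100 (credit: res-type-100 g12; B8/B9 lineage res-type-100 / res-L1-w45b-stub-1 / -stub-2 / -stub-3 / res-D-pv-029 / -051)
RE-RUN VERBATIM with the SAME witnesses (`X₁`, `τ₁ ≫ σ'`, `j₂`, `t₂`, carrier `𝓢 := (ker s)·𝒪_{X₁}`, cone `St_{τ₁} K₀`) and TWO MORE CLAUSES, the seed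
plane being the exceptional plane `S₂ := υ⁻¹{x}` of the first point step:
* (ix) PLANE TRACE `((ker s)·𝒪_{X₁})·𝒪_{F₂} = 𝓘⟨closure υ⁻¹{x}⟩`: the carrier identity `hcarrier` (`= 𝓘{x}·𝒪_{F₂}`) followed by res-L1-w45b-lead-1's
  LOCAL reduced-exceptional-plane lemma `comap_vanishingIdeal_singleton_eq_of_isRegularLocalRing` (…NatReducedExceptionalPlaneLocal p616407: the
  exceptional divisor of the blow-up of a reduced REGULAR closed point is reduced) — ONE extra hypothesis `hxreg : IsRegularLocalRing (F₁.presheaf.stalk x)`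
  (the assembly's binder `hxreg`);
* (x) PLANE FLATNESS `V((ker s)·𝒪_{X₁}) → Spec O` flat: `flat_exceptional_of_isBlowup_regularCentre` (…CentreBlowupFlatExceptional; Liu 8.1.19 (b)) over
  `flat_kerSubschemeι_comp_of_section` (`V(ker s) ≅ Spec O`).
* `tcPlus_memberS_uncentred`, `tcPlus_memberS_centred`, **`inv_baseS`** (= `inv_baseKCL` over the two S bricks; conclusion
  `TCPlus.InvS … W F₂ (𝟙 F₂) (St T₁) (υ⁻¹{x} ∩ St_x W) (St_x W) (υ⁻¹{x}) false`).

References: Q. Liu, *Algebraic Geometry and Arithmetic Curves* (2002), Thm. 8.1.19 (b) [Liu2002]; H. Matsumura, *Commutative Ring Theory* (1986),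
Thm. 14.2 [Matsumura1987]; The Stacks Project, Tag 0804 [StacksProject] — through the cited tree files.
-/

set_option linter.dupNamespace false -- mandated namespace `Summit.<Summit>.<Problem>` of this single-conjunct summit
set_option linter.overlappingInstances false -- the binders carry `[IsDomain O] [IsDiscreteValuationRing O]`

noncomputable section

open CategoryTheory CategoryTheory.Limits AlgebraicGeometry TopologicalSpace IsLocalRing
open Literature.AlgebraicGeometry.Resolution
open AlgebraicGeometry.Scheme.IdealSheafData
open Summit.ResolutionOfSingularities.ResolutionOfSingularities.Cruxes.EquisingularLift.StrataSplit

namespace Summit.ResolutionOfSingularities.ResolutionOfSingularities.Cruxes.EquisingularLiftNat.Sections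

/-! ## The uncentred member with plane trace and plane flatness -/

/-- **`TCPlus.MemberS … F₂ T₂ Z₂ (St_x W) (υ⁻¹{x}) ∅` — THE UNCENTRED MEMBER OF `inv_baseS` WITH SHADOW, CARTIER CLAUSE, PLANE TRACE AND PLANE
FLATNESS.** res-type-100's `tcPlus_memberKCL_uncentred` VERBATIM (same witnesses) plus (ix) from `hcarrier` and res-L1-w45b-lead-1's
`comap_vanishingIdeal_singleton_eq_of_isRegularLocalRing` (extra hypothesis `hxreg`) and (x) from `flat_exceptional_of_isBlowup_regularCentre`.
[cite: Liu2002, Thm. 8.1.19 (b)] [cite: Matsumura1987, Thm. 14.2] [cite: StacksProject, Tag 0804] [OURS · L1 W4.5b · T23-A″-S] brick (S-6), uncentred member;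
NOT a statement of the manuscript. -/
theorem tcPlus_memberS_uncentred (p : ℕ) [Fact p.Prime] (k : Type) [Field k] [CharP k p] [IsAlgClosed k] (O : Type) [CommRing O]
    [IsDomain O] [IsDiscreteValuationRing O] [IsAdicComplete (IsLocalRing.maximalIdeal O) O] [IsAlgClosed (IsLocalRing.ResidueField O)]
    (θ : O →+* k) (hθ : Function.Surjective θ) (P : Scheme.{0}) (q : P ⟶ Spec (.of O)) (Y : Set P)
    (Ch : ∀ X' : Scheme.{0}, (X' ⟶ P) → Set X' → Prop)
    (hChSplit : ∀ (X' : Scheme.{0}) (σ' : X' ⟶ P) (S' : Set X'), Ch X' σ' S' →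
      Summit.ResolutionOfSingularities.ResolutionOfSingularities.Theses.EquisingularLift.Split.Chain P Y X' σ' S')
    (hPnoeth : IsLocallyNoetherian P) (hPreg : Scheme.IsRegular P) [IsProper q]
    (X' : Scheme.{0}) (σ' : X' ⟶ P) (S' : Set X') (hCh' : Ch X' σ' S') [IsIntegral X'] [IsLocallyNoetherian X']
    (hX'reg : Scheme.IsRegular X') (F₁ : Scheme.{0}) [IsIntegral F₁] (j : F₁ ⟶ X') (t : F₁ ⟶ Spec (.of k))
    (hsq : IsPullback j t (σ' ≫ q) (Spec.map (CommRingCat.ofHom θ))) (T₁ : Set F₁) (x : F₁) (hx : IsClosed ({x} : Set F₁))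
    (hxreg : IsRegularLocalRing (F₁.presheaf.stalk x)) (U : X'.Opens) (hU : Smooth (U.ι ≫ σ' ≫ q)) (s : Spec (.of O) ⟶ X') (hs : s ≫ σ' ≫ q = 𝟙 _)
    (hsU : s (IsLocalRing.closedPoint O) ∈ U) (hsx : s (IsLocalRing.closedPoint O) = j x)
    (hdim : ringKrullDim (X'.presheaf.stalk (s (IsLocalRing.closedPoint O))) = ((3 + 1 : ℕ) : WithBot ℕ∞))
    (hsoff : ∀ c ∈ (s.ker.support : Set X'), ¬ IsGenericPoint (σ' c) Y)
    (X₁ : Scheme.{0}) (τ₁ : X₁ ⟶ X') (hτ₁ : IsBlowup τ₁ s.ker) [IsIntegral X₁] [IsLocallyNoetherian X₁]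
    (hX₁reg : Scheme.IsRegular X₁) (hX₁dom : IsDominant ((τ₁ ≫ σ') ≫ q))
    (F₂ : Scheme.{0}) [IsIntegral F₂] (υ : F₂ ⟶ F₁) (hυ : IsBlowup υ (vanishingIdeal (⟨{x}, hx⟩ : Closeds F₁)))
    (j₂ : F₂ ⟶ X₁) (t₂ : F₂ ⟶ Spec (.of k)) (hsq₂ : IsPullback j₂ t₂ ((τ₁ ≫ σ') ≫ q) (Spec.map (CommRingCat.ofHom θ)))
    (hcomm : j₂ ≫ τ₁ = υ ≫ j) (hcarrier : (s.ker.comap τ₁).comap j₂ = (vanishingIdeal (⟨{x}, hx⟩ : Closeds F₁)).comap υ)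
    (hCh₁ : Ch X₁ (τ₁ ≫ σ') (j₂ '' closure (υ ⁻¹' (T₁ \ {x}))))
    (W : Set F₁) (hnot : ¬ (υ ⁻¹' {x} ⊆ closure (υ ⁻¹' (W \ {x})))) (hcone : ConeForm F₁ x W) :
    TCPlus.MemberS O k θ P q Y Ch F₂ (closure (υ ⁻¹' (T₁ \ {x}))) (υ ⁻¹' {x} ∩ closure (υ ⁻¹' (W \ {x})))
      (closure (υ ⁻¹' (W \ {x}))) (υ ⁻¹' {x}) ∅ := by
  -- adapted from res-type-100's `tcPlus_memberKCL_uncentred` (…NatTCPlusMemberKCLUncentred): same witnesses, two more clauses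
  haveI : IsProper σ' := (chain_isRegular P Y X' σ' S' (hChSplit X' σ' S' hCh') hPnoeth hPreg).2.2
  haveI : IsProper (σ' ≫ q) := inferInstance
  have hZ : IsClosed (υ ⁻¹' {x} ∩ closure (υ ⁻¹' (W \ {x}))) := (hx.preimage υ.continuous).inter isClosed_closure
  have hsq₂' : IsPullback j₂ t₂ (τ₁ ≫ σ' ≫ q) (Spec.map (CommRingCat.ofHom θ)) := by
    simpa only [Category.assoc] using hsq₂
  -- the cone germ in the `ConeForm` frame (`n = 3`: the plane lift, no finiteness input)
  obtain ⟨hEreg, hEpr, f, hf0, hK⟩ := exists_coneGerm_of_admTC_coneForm p k 3 O θ hθ X' (σ' ≫ q) hX'reg inferInstance U hU s hs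
    hsU hdim X₁ τ₁ hτ₁ F₁ j t hsq x hx hsx F₂ υ hυ j₂ t₂ hsq₂' hcomm hcarrier W hZ hnot hcone (Or.inl rfl)
  -- the prescribed-germ Cartier divisor with germ `f`, and the clauses for its strict transform
  obtain ⟨K₀, hK₀pr, hK₀⟩ := exists_forall_isPrincipal_stalkIdeal_eq_span hX'reg (j x) hf0
  obtain ⟨hi, hii, -, hiv, hv, hcodim, -, hvii⟩ := hK K₀ hK₀
  -- the section centre is regular and non-zero
  obtain ⟨-, hsreg, -, hsupp⟩ := section_isClosedImmersion_and_isRegular_ker O X' (σ' ≫ q) s hs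
  obtain ⟨y₁⟩ := (inferInstance : Nonempty F₂)
  have hs0 : s.ker ≠ ⊥ := ne_bot_of_isBlowup hτ₁ (j₂ y₁)
  haveI : IsLocallyNoetherian X₁ := ‹_›
  -- the model square: `j` is a closed immersion, so `F₁` is locally Noetherian (for the reduced-exceptional-plane lemma)
  haveI : IsClosedImmersion (Spec.map (CommRingCat.ofHom θ)) := IsClosedImmersion.spec_of_surjective _ hθ
  haveI : IsClosedImmersion j := MorphismProperty.IsStableUnderBaseChange.of_isPullback hsq.flip inferInstance
  haveI : IsLocallyNoetherian F₁ := LocallyOfFiniteType.isLocallyNoetherian j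
  refine ⟨X₁, τ₁ ≫ σ', _, j₂, t₂, s.ker.comap τ₁, strictTransformIdeal τ₁ s.ker K₀, hCh₁, ‹_›, ‹_›, hX₁reg, hX₁dom, hsq₂,
    rfl, ?_, ?_, hEreg, fun z => ⟨hEpr z, ?_⟩, ?_, fun z hz hzq _ => ⟨hv z hz, fun _ => hcodim z hz ?_⟩, ?_, ?_, ?_, ?_, ?_⟩
  · -- (i) exact special fibre
    have hcl : (⟨closure (υ ⁻¹' {x} ∩ closure (υ ⁻¹' (W \ {x}))), isClosed_closure⟩ : Closeds F₂) =
        ⟨υ ⁻¹' {x} ∩ closure (υ ⁻¹' (W \ {x})), hZ⟩ := Closeds.ext hZ.closure_eq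
    rw [hcl]; exact hi
  · -- (ii) flat over `O`
    simpa only [Category.assoc] using hii
  · -- (iii) the cone is principal at every point (res-D-pv-032, p529806)
    exact isPrincipal_stalkIdeal_strictTransformIdeal hX'reg hsreg hτ₁ hs0 K₀ hK₀pr z
  · -- (iv) off the generic points of `Y`
    rintro _ ⟨z, hz, rfl⟩
    have hzE : τ₁ z ∈ (s.ker.support : Set X') := by
      have h := hiv hz
      rw [SetLike.mem_coe, Scheme.IdealSheafData.support_comap] at h
      exact h
    rw [Scheme.Hom.comp_apply]
    exact hsoff _ hzE
  · -- (v) the special points lie over the closed point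
    simpa only [Category.assoc] using hzq
  · -- (vi) no excluded point
    intro y₀ hy₀
    exact absurd hy₀ (Set.notMem_empty _)
  · -- (vii-loc) the localized shadow trace (closure of the closed shadow)
    obtain ⟨V, hxV, hV⟩ := hvii
    have hcl : (⟨closure (closure (υ ⁻¹' (W \ {x}))), isClosed_closure⟩ : Closeds F₂) =
        ⟨closure (υ ⁻¹' (W \ {x})), isClosed_closure⟩ := Closeds.ext closure_closure
    exact ⟨V, Set.inter_subset_left.trans hxV, by rw [hcl]; exact hV⟩
  · -- (viii) the carrier cuts an effective Cartier divisor on the cone (res-type-100, …NatStrictTransformExceptionalCartier)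
    exact isEffectiveCartier_comap_subschemeι_strictTransformIdeal τ₁ s.ker K₀ hτ₁.isEffectiveCartier
  · -- (ix) the plane trace: `hcarrier` + the REDUCED exceptional plane of the blow-up of a regular point (res-L1-w45b-lead-1)
    rw [hcarrier, comap_vanishingIdeal_singleton_eq_of_isRegularLocalRing hx hxreg hυ]
    congr 1
    exact Closeds.ext (hx.preimage υ.continuous).closure_eq.symm
  · -- (x) the plane's model `V((ker s)·𝒪_{X₁})` is flat over `O` (Liu 8.1.19 (b); `V(ker s) ≅ Spec O` regular and `O`-flat)
    have h := flat_exceptional_of_isBlowup_regularCentre O X' X₁ (σ' ≫ q) s.ker hX'reg hsreg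
      (flat_kerSubschemeι_comp_of_section O (σ' ≫ q) s hs) τ₁ hτ₁
    simpa only [Category.assoc] using h


/-! ## The centred member and the invariant -/

set_option maxHeartbeats 800000 in -- long assembly over the chart algebra `blowupAlgebra` (slow instance unification, cf. p540528)
/-- **THE CENTRED MEMBER WITH SHADOW, CARTIER CLAUSE, PLANE TRACE AND PLANE FLATNESS at a closed point of the trace**
(`TCPlus.MemberS … F₂ T₂ Z₂ (St_x W) (υ⁻¹{x}) {y′}`): res-type-100's `tcPlus_memberKCL_centred` VERBATIM (same witnesses) plus (ix) from `hcarrier` and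
res-L1-w45b-lead-1's `comap_vanishingIdeal_singleton_eq_of_isRegularLocalRing` (extra hypothesis `hxreg`) and (x) from
`flat_exceptional_of_isBlowup_regularCentre`. [cite: Liu2002, Thm. 8.1.19 (b)] [cite: Matsumura1987, Thm. 14.2] [cite: StacksProject, Tag 0804]
[OURS · L1 W4.5b · T23-A″-S] brick (S-6), centred member; NOT a statement of the manuscript. -/
theorem tcPlus_memberS_centred (p : ℕ) [Fact p.Prime] (k : Type) [Field k] [CharP k p] [IsAlgClosed k] (O : Type) [CommRing O]
    [IsDomain O]
    [IsDiscreteValuationRing O] [IsAdicComplete (IsLocalRing.maximalIdeal O) O] [IsAlgClosed (IsLocalRing.ResidueField O)]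
    (θ : O →+* k) (hθ : Function.Surjective θ) (P : Scheme.{0}) (q : P ⟶ Spec (.of O)) (Y : Set P)
    (Ch : ∀ X' : Scheme.{0}, (X' ⟶ P) → Set X' → Prop)
    (hChSplit : ∀ (X' : Scheme.{0}) (σ' : X' ⟶ P) (S' : Set X'), Ch X' σ' S' →
      Summit.ResolutionOfSingularities.ResolutionOfSingularities.Theses.EquisingularLift.Split.Chain P Y X' σ' S')
    (hPnoeth : IsLocallyNoetherian P) (hPreg : Scheme.IsRegular P) [IsProper q]
    (X' : Scheme.{0}) (σ' : X' ⟶ P) (S' : Set X') (hCh' : Ch X' σ' S') [IsIntegral X'] [IsLocallyNoetherian X']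
    (hX'reg : Scheme.IsRegular X') (F₁ : Scheme.{0}) [IsIntegral F₁] (j : F₁ ⟶ X') (t : F₁ ⟶ Spec (.of k))
    (hsq : IsPullback j t (σ' ≫ q) (Spec.map (CommRingCat.ofHom θ))) (T₁ : Set F₁) (x : F₁) (hx : IsClosed ({x} : Set F₁))
    (hxreg : IsRegularLocalRing (F₁.presheaf.stalk x))
    (s : Spec (.of O) ⟶ X') (hs : s ≫ σ' ≫ q = 𝟙 _) (hsx : s (IsLocalRing.closedPoint O) = j x)
    (hdim : ringKrullDim (X'.presheaf.stalk (s (IsLocalRing.closedPoint O))) = ((3 + 1 : ℕ) : WithBot ℕ∞))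
    (hsoff : ∀ c ∈ (s.ker.support : Set X'), ¬ IsGenericPoint (σ' c) Y)
    (X₁ : Scheme.{0}) (τ₁ : X₁ ⟶ X') (hτ₁ : IsBlowup τ₁ s.ker) [IsIntegral X₁] [IsLocallyNoetherian X₁]
    (hX₁reg : Scheme.IsRegular X₁) (hX₁dom : IsDominant ((τ₁ ≫ σ') ≫ q))
    (F₂ : Scheme.{0}) [IsIntegral F₂] (υ : F₂ ⟶ F₁) (hυ : IsBlowup υ (vanishingIdeal (⟨{x}, hx⟩ : Closeds F₁)))
    (j₂ : F₂ ⟶ X₁) (t₂ : F₂ ⟶ Spec (.of k)) (hsq₂ : IsPullback j₂ t₂ ((τ₁ ≫ σ') ≫ q) (Spec.map (CommRingCat.ofHom θ)))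
    (hcomm : j₂ ≫ τ₁ = υ ≫ j) (hcarrier : (s.ker.comap τ₁).comap j₂ = (vanishingIdeal (⟨{x}, hx⟩ : Closeds F₁)).comap υ)
    (hCh₁ : Ch X₁ (τ₁ ≫ σ') (j₂ '' closure (υ ⁻¹' (T₁ \ {x}))))
    (W : Set F₁) (hnot : ¬ (υ ⁻¹' {x} ⊆ closure (υ ⁻¹' (W \ {x})))) (hcone : ConeForm F₁ x W)
    (y' : F₂) (hy' : y' ∈ υ ⁻¹' {x} ∩ closure (υ ⁻¹' (W \ {x}))) (hy'c : IsClosed ({y'} : Set F₂)) :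
    TCPlus.MemberS O k θ P q Y Ch F₂ (closure (υ ⁻¹' (T₁ \ {x}))) (υ ⁻¹' {x} ∩ closure (υ ⁻¹' (W \ {x})))
      (closure (υ ⁻¹' (W \ {x}))) (υ ⁻¹' {x}) {y'} := by
  classical
  -- properness of the stage, closed immersions of the model squares, Noetherianity of the fibres
  haveI : IsProper σ' := (chain_isRegular P Y X' σ' S' (hChSplit X' σ' S' hCh') hPnoeth hPreg).2.2
  haveI : IsProper (σ' ≫ q) := inferInstance
  haveI : IsProper τ₁ := hτ₁.isProper
  haveI : IsClosedImmersion (Spec.map (CommRingCat.ofHom θ)) := IsClosedImmersion.spec_of_surjective _ hθ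
  haveI : IsClosedImmersion j := MorphismProperty.IsStableUnderBaseChange.of_isPullback hsq.flip inferInstance
  haveI : IsClosedImmersion j₂ := MorphismProperty.IsStableUnderBaseChange.of_isPullback hsq₂.flip inferInstance
  haveI : IsLocallyNoetherian F₁ := LocallyOfFiniteType.isLocallyNoetherian j
  haveI : IsLocallyNoetherian F₂ := by
    haveI : IsProper υ := hυ.isProper
    exact LocallyOfFiniteType.isLocallyNoetherian υ
  have hZ : IsClosed (υ ⁻¹' {x} ∩ closure (υ ⁻¹' (W \ {x}))) := (hx.preimage υ.continuous).inter isClosed_closure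
  have hsq₂' : IsPullback j₂ t₂ (τ₁ ≫ σ' ≫ q) (Spec.map (CommRingCat.ofHom θ)) := by
    simpa only [Category.assoc] using hsq₂
  have hy'x : υ y' = x := hy'.1
  have hpc : τ₁ (j₂ y') = j x := by rw [← Scheme.Hom.comp_apply, hcomm, Scheme.Hom.comp_apply, hy'x]
  -- B4a★: the adapted frame, the centred cone form, T-ΔLIFT-CENTRED, the exact special fibre of every cone ideal with that germ
  obtain ⟨c, θR, d, m, Φ, Φu, Φv, hcI, hqr, hdom, hθR, hframe, hcb𝔪, hcbar, Hp, hm1, -, hΦd, hΦcen, hΦexact, hΦres, hΦι, -, hΔ,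
      hΦu, hΦv, hregu, hregv, hfib⟩ :=
    exists_centredConeLift_three_exact_coneForm p k O θ hθ X' (σ' ≫ q) hX'reg s hs hdim X₁ τ₁ hτ₁ F₁ j t hsq x hx hsx F₂ υ hυ j₂
      hcomm W hZ hnot hcone y' hy' hy'c
  haveI := hdom
  haveI : IsRegularRing (X'.presheaf.stalk (j x) ⧸ Ideal.span (Set.range c)) := IsRegularRing.of_ringEquiv θR.symm
  obtain ⟨ϖ, hϖ⟩ := IsDiscreteValuationRing.exists_irreducible O
  have hΦιd : (MvPolynomial.map ((Scheme.ΓSpecIso (.of O)).inv ≫ (σ' ≫ q).appTop ≫ X'.presheaf.Γgerm (j x)).hom Φ).IsHomogeneous d :=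
    hΦd.map _
  -- the section centre: regular, non-zero, through `j x`
  obtain ⟨-, hsreg, -, hsupp⟩ := section_isClosedImmersion_and_isRegular_ker O X' (σ' ≫ q) s hs
  have hpJ : j x ∈ (s.ker.support : Set X') := by rw [hsupp, ← hsx]; exact Set.mem_range_self _
  have hs0 : s.ker ≠ ⊥ := ne_bot_of_isBlowup hτ₁ (j₂ y')
  have hItop : Ideal.span (Set.range c) ≠ ⊤ := by
    rw [hcI]
    exact ne_top_of_le_ne_top (Ideal.IsMaximal.ne_top (IsLocalRing.maximalIdeal.isMaximal _))
      ((mem_support_iff_stalkIdeal_le _ _).mp hpJ)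
  -- part 1c: the prescribed-germ Cartier divisors `L₁, L₂` (axis) and `K₀` (cone)
  obtain ⟨L₁, -, hL₁⟩ := exists_forall_isPrincipal_stalkIdeal_eq_span hX'reg (j x) (ne_zero_of_isQuasiRegular hqr hItop 1)
  obtain ⟨L₂, -, hL₂⟩ := exists_forall_isPrincipal_stalkIdeal_eq_span hX'reg (j x) (ne_zero_of_isQuasiRegular hqr hItop 2)
  obtain ⟨K₀, hK₀pr, hK₀⟩ := exists_forall_isPrincipal_stalkIdeal_eq_span hX'reg (j x) (eval_ne_zero_of_isQuasiRegular hqr hΦιd hΦι)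
  -- B6a: the chart-`0` presentation of `𝒪_{X₁,j₂ y′}`
  obtain ⟨𝔔₁, χ₁, -, hχ₁, hloc₁, -, h𝔔₁, hu⟩ :=
    exists_conePoint_presentation hτ₁ j hx hυ j₂ hcomm hcarrier c hcI hcb𝔪 y' hy'x hpc Hp
  -- B6b (res-D-pv-051 / res-D-pv-029): the axis section through the cone point
  obtain ⟨s_c, hsc, hpt, hle, hst, -, -⟩ := exists_axisSection_conePoint O k θ hθ (σ' ≫ q) s hs hτ₁ j hx hυ j₂ hcomm t₂ hsq₂'
    hsx c hcI hqr θR hcb𝔪 hcbar L₁ L₂ hL₁ hL₂ y' hy'x hy'c hpc 𝔔₁ χ₁ hχ₁ hloc₁ h𝔔₁ hu Hp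
  -- T-DIM at the closed point `j₂ y′`
  have hcl₁ : IsClosed ({j₂ y'} : Set X₁) := by
    simpa only [Set.image_singleton] using j₂.isClosedEmbedding.isClosedMap _ hy'c
  have hdim₁ : ringKrullDim (X₁.presheaf.stalk (j₂ y')) = ((3 + 1 : ℕ) : WithBot ℕ∞) := by
    have hUC := isUniversallyCatenaryRing_stalk_of_locallyOfFiniteType (isUniversallyCatenaryRing_of_isDiscreteValuationRing O)
      (σ' ≫ q) (τ₁.base (j₂ y'))
    rw [ringKrullDim_stalk_eq_of_isBlowup_of_isClosed hτ₁ hcl₁ hUC]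
    change ringKrullDim (X'.presheaf.stalk (τ₁ (j₂ y'))) = _
    rw [hpc, ← hsx]
    exact hdim
  -- B4b: flatness and support of the pair
  have hdimx : ringKrullDim (X'.presheaf.stalk (j x)) = ((3 + 1 : ℕ) : WithBot ℕ∞) := by rw [← hsx]; exact hdim
  obtain ⟨hflat, hsuppE, -⟩ := carrierPair_flat_support_of_stalk O (σ' ≫ q) s hs (j x) hsx (hX'reg (j x)) τ₁ hτ₁ ϖ hϖ c hcI
    hdimx Φ hΦd hΦres K₀ hK₀
  refine ⟨X₁, τ₁ ≫ σ', _, j₂, t₂, s.ker.comap τ₁, strictTransformIdeal τ₁ s.ker K₀, hCh₁, ‹_›, ‹_›, hX₁reg, hX₁dom, hsq₂,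
    rfl, ?_, ?_, isRegular_exceptional_subscheme O (σ' ≫ q) s hs (j x) hsx τ₁ hτ₁ c hcI hqr θR, fun z => ⟨?_, ?_⟩, ?_,
    fun z hz hzq hzex => ?_, fun y₀ hy₀ => ?_, ?_,
    isEffectiveCartier_comap_subschemeι_strictTransformIdeal τ₁ s.ker K₀ hτ₁.isEffectiveCartier, ?_, ?_⟩
  · -- (i) exact special fibre (B4a★)
    have hcl : (⟨closure (υ ⁻¹' {x} ∩ closure (υ ⁻¹' (W \ {x}))), isClosed_closure⟩ : Closeds F₂) =
        ⟨υ ⁻¹' {x} ∩ closure (υ ⁻¹' (W \ {x})), hZ⟩ := Closeds.ext hZ.closure_eq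
    rw [hcl]; exact (hfib K₀ hK₀).1
  · -- (ii) flat over `O` (B4b)
    rw [show s.ker.comap τ₁ ⊔ strictTransformIdeal τ₁ s.ker K₀ = strictTransformIdeal τ₁ s.ker K₀ ⊔ s.ker.comap τ₁ from sup_comm _ _]
    simpa only [Category.assoc] using hflat
  · -- (iii) `E` is locally principal (an effective Cartier divisor)
    obtain ⟨g, -, hg⟩ := hτ₁.isEffectiveCartier.exists_stalkIdeal_eq_span z
    exact ⟨⟨g, hg⟩⟩
  · -- (iii) the cone is principal at every point (res-D-pv-032, p529806)
    exact isPrincipal_stalkIdeal_strictTransformIdeal hX'reg hsreg hτ₁ hs0 K₀ hK₀pr z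
  · -- (iv) off the generic points of `Y` (B4b support + `hsoff`)
    rintro _ ⟨z, hz, rfl⟩
    rw [show s.ker.comap τ₁ ⊔ strictTransformIdeal τ₁ s.ker K₀ = strictTransformIdeal τ₁ s.ker K₀ ⊔ s.ker.comap τ₁ from
      sup_comm _ _] at hz
    have hzE : τ₁ z ∈ (s.ker.support : Set X') := by
      have h := hsuppE hz
      rw [SetLike.mem_coe, Scheme.IdealSheafData.support_comap] at h
      exact h
    rw [Scheme.Hom.comp_apply]
    exact hsoff _ hzE
  · -- (v) off the cone point (res-L1-w45b-stub-2 B5)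
    have hne : z ≠ j₂ y' := by
      rintro rfl
      exact hzex ⟨y', rfl, rfl⟩
    have h := isRegularLocalRing_quotient_carrierDelta_of_ne_conePoint k O θ hθ (σ' ≫ q) s hs j t hsq x hx hsx τ₁ hτ₁ υ hυ j₂ t₂
      hsq₂' hcomm hcarrier c hcI hqr θR hθR hframe Φ hΦd hΦι hΔ K₀ hK₀ y' hy'x Hp z hz (by simpa only [Category.assoc] using hzq) hne
    exact ⟨h.1, fun _ => h.2⟩
  · -- (vi) the centred package at the cone point (res-L1-w45b-stub-3 B6c)
    rw [Set.mem_singleton_iff] at hy₀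
    rw [hy₀]
    exact TCPlus.tcPlus_centredPackage_of_axisSection O ϖ hϖ P q σ' (σ' ≫ q) K₀ (j₂ y') (j x) hpc hpJ c hcI hqr θR hθR
      (hframe ϖ hϖ).1 𝔔₁ χ₁ hχ₁ hloc₁ h𝔔₁ hu (hX₁reg (j₂ y')) hdim₁ s_c (by simpa only [Category.assoc] using hsc) hpt
      (le_sup_left.trans (le_sup_left.trans hle)) hst Φ hm1 hΦd hΦcen hΦexact hΦι hK₀ Φu Φv hΦu hΦv (hregu ϖ hϖ) (hregv ϖ hϖ)
  · -- (vii-loc) the localized shadow trace (B4a★′; closure of the closed shadow)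
    obtain ⟨V, hxV, hV⟩ := (hfib K₀ hK₀).2
    have hcl : (⟨closure (closure (υ ⁻¹' (W \ {x}))), isClosed_closure⟩ : Closeds F₂) =
        ⟨closure (υ ⁻¹' (W \ {x})), isClosed_closure⟩ := Closeds.ext closure_closure
    exact ⟨V, Set.inter_subset_left.trans hxV, by rw [hcl]; exact hV⟩
  · -- (ix) the plane trace: `hcarrier` + the REDUCED exceptional plane of the blow-up of a regular point (res-L1-w45b-lead-1)
    rw [hcarrier, comap_vanishingIdeal_singleton_eq_of_isRegularLocalRing hx hxreg hυ]
    congr 1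
    exact Closeds.ext (hx.preimage υ.continuous).closure_eq.symm
  · -- (x) the plane's model `V((ker s)·𝒪_{X₁})` is flat over `O` (Liu 8.1.19 (b); `V(ker s) ≅ Spec O` regular and `O`-flat)
    have h := flat_exceptional_of_isBlowup_regularCentre O X' X₁ (σ' ≫ q) s.ker hX'reg hsreg
      (flat_kerSubschemeι_comp_of_section O (σ' ≫ q) s hs) τ₁ hτ₁
    simpa only [Category.assoc] using h

/-- **`inv_baseS` — THE INVARIANT WITH LOCALIZED SHADOW, CARTIER CLAUSE, PLANE TRACE AND PLANE FLATNESS AT THE FIRST POINT STEP**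
(`TCPlus.InvS … W F₂ (𝟙 F₂) T₂ Z₂ (St_x W) (υ⁻¹{x}) false`; the (base) clause of the B″-S inner driver at `INV := InvS`): res-type-100's `inv_baseKCL`
VERBATIM over the S bricks `tcPlus_memberS_uncentred` / `tcPlus_memberS_centred`; ONE extra hypothesis `hxreg : IsRegularLocalRing (F₁.presheaf.stalk x)`.
[cite: Liu2002, Thm. 8.1.19 (b)] [cite: Matsumura1987, Thm. 14.2] [cite: StacksProject, Tag 0804] [OURS · L1 W4.5b · T23-A″-S] brick (S-6); NOT a statement of
the manuscript. -/
theorem inv_baseS (p : ℕ) [Fact p.Prime] (k : Type) [Field k] [CharP k p] [IsAlgClosed k] (O : Type) [CommRing O] [IsDomain O]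
    [IsDiscreteValuationRing O] [IsAdicComplete (IsLocalRing.maximalIdeal O) O] [IsAlgClosed (IsLocalRing.ResidueField O)]
    (θ : O →+* k) (hθ : Function.Surjective θ) (P : Scheme.{0}) (q : P ⟶ Spec (.of O)) (Y : Set P)
    (Ch : ∀ X' : Scheme.{0}, (X' ⟶ P) → Set X' → Prop)
    (hChSplit : ∀ (X' : Scheme.{0}) (σ' : X' ⟶ P) (S' : Set X'), Ch X' σ' S' →
      Summit.ResolutionOfSingularities.ResolutionOfSingularities.Theses.EquisingularLift.Split.Chain P Y X' σ' S')
    (hPnoeth : IsLocallyNoetherian P) (hPreg : Scheme.IsRegular P) [IsProper q]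
    (X' : Scheme.{0}) (σ' : X' ⟶ P) (S' : Set X') (hCh' : Ch X' σ' S') [IsIntegral X'] [IsLocallyNoetherian X']
    (hX'reg : Scheme.IsRegular X') (F₁ : Scheme.{0}) [IsIntegral F₁] (j : F₁ ⟶ X') (t : F₁ ⟶ Spec (.of k))
    (hsq : IsPullback j t (σ' ≫ q) (Spec.map (CommRingCat.ofHom θ))) (T₁ : Set F₁) (x : F₁) (hx : IsClosed ({x} : Set F₁))
    (hxreg : IsRegularLocalRing (F₁.presheaf.stalk x))
    (U : X'.Opens) (hU : Smooth (U.ι ≫ σ' ≫ q)) (s : Spec (.of O) ⟶ X') (hs : s ≫ σ' ≫ q = 𝟙 _)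
    (hsU : s (IsLocalRing.closedPoint O) ∈ U) (hsx : s (IsLocalRing.closedPoint O) = j x)
    (hdim : ringKrullDim (X'.presheaf.stalk (s (IsLocalRing.closedPoint O))) = ((3 + 1 : ℕ) : WithBot ℕ∞))
    (hsoff : ∀ c ∈ (s.ker.support : Set X'), ¬ IsGenericPoint (σ' c) Y)
    (X₁ : Scheme.{0}) (τ₁ : X₁ ⟶ X') (hτ₁ : IsBlowup τ₁ s.ker) [IsIntegral X₁] [IsLocallyNoetherian X₁]
    (hX₁reg : Scheme.IsRegular X₁) (hX₁dom : IsDominant ((τ₁ ≫ σ') ≫ q))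
    (F₂ : Scheme.{0}) [IsIntegral F₂] (υ : F₂ ⟶ F₁) (hυ : IsBlowup υ (vanishingIdeal (⟨{x}, hx⟩ : Closeds F₁)))
    (j₂ : F₂ ⟶ X₁) (t₂ : F₂ ⟶ Spec (.of k)) (hsq₂ : IsPullback j₂ t₂ ((τ₁ ≫ σ') ≫ q) (Spec.map (CommRingCat.ofHom θ)))
    (hcomm : j₂ ≫ τ₁ = υ ≫ j) (hcarrier : (s.ker.comap τ₁).comap j₂ = (vanishingIdeal (⟨{x}, hx⟩ : Closeds F₁)).comap υ)
    (hCh₁ : Ch X₁ (τ₁ ≫ σ') (j₂ '' closure (υ ⁻¹' (T₁ \ {x}))))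
    (hirr₂ : IsIrreducible (closure (υ ⁻¹' (T₁ \ {x}))))
    (W : Set F₁) (hnot : ¬ (υ ⁻¹' {x} ⊆ closure (υ ⁻¹' (W \ {x})))) (hcone : ConeForm F₁ x W) :
    TCPlus.InvS O k θ P q Y Ch W F₂ (𝟙 F₂) (closure (υ ⁻¹' (T₁ \ {x}))) (υ ⁻¹' {x} ∩ closure (υ ⁻¹' (W \ {x})))
      (closure (υ ⁻¹' (W \ {x}))) (υ ⁻¹' {x}) false := by
  have hZ : IsClosed (υ ⁻¹' {x} ∩ closure (υ ⁻¹' (W \ {x}))) := (hx.preimage υ.continuous).inter isClosed_closure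
  refine ⟨‹_›, isClosed_closure, hirr₂, fun hsub => ?_,
    tcPlus_memberS_uncentred p k O θ hθ P q Y Ch hChSplit hPnoeth hPreg X' σ' S' hCh' hX'reg F₁ j t hsq T₁ x hx hxreg U hU s hs hsU
      hsx hdim hsoff X₁ τ₁ hτ₁ hX₁reg hX₁dom F₂ υ hυ j₂ t₂ hsq₂ hcomm hcarrier hCh₁ W hnot hcone,
    fun _ y hycl _ => ?_⟩
  · -- `T₂ ⊄ closure Z₂ = Z₂ ⊆ υ⁻¹{x}`: a point of `υ⁻¹(T₁ ∖ {x}) ≠ ∅`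
    obtain ⟨y, hyT⟩ := closure_nonempty_iff.mp hirr₂.nonempty
    have hyZ := hZ.closure_subset (hsub (subset_closure hyT))
    exact hyT.2 hyZ.1
  · -- the centred member at a closed point of the reduced trace (B8)
    refine tcPlus_memberS_centred p k O θ hθ P q Y Ch hChSplit hPnoeth hPreg X' σ' S' hCh' hX'reg F₁ j t hsq T₁ x hx hxreg s hs hsx
      hdim hsoff X₁ τ₁ hτ₁ hX₁reg hX₁dom F₂ υ hυ j₂ t₂ hsq₂ hcomm hcarrier hCh₁ W hnot hcone _ ?_ hycl
    have hmem : ((vanishingIdeal (⟨closure (υ ⁻¹' {x} ∩ closure (υ ⁻¹' (W \ {x}))), isClosed_closure⟩ :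
        Closeds F₂)).subschemeι y : F₂) ∈ closure (υ ⁻¹' {x} ∩ closure (υ ⁻¹' (W \ {x}))) := by
      have h := Set.mem_range_self (f := fun y' => ((vanishingIdeal (⟨closure (υ ⁻¹' {x} ∩ closure (υ ⁻¹' (W \ {x}))),
        isClosed_closure⟩ : Closeds F₂)).subschemeι y' : F₂)) y
      rw [Scheme.IdealSheafData.range_subschemeι, Scheme.IdealSheafData.coe_support_vanishingIdeal] at h
      exact h
    exact hZ.closure_subset hmem

end Summit.ResolutionOfSingularities.ResolutionOfSingularities.Cruxes.EquisingularLiftNat.Sections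

end
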